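import Literature.IUT.HodgeTheaters.PiAvatarBaseKitNF
import Literature.IUT.HodgeTheaters.PiAvatarLocalArrowLawOfTorsionMonodromy
import HarnessLib

/-!
# J-NF-1 instances: the NF-widened [IUTchI] §6 base kit AT THE INITIAL Θ-DATA — `baseKitNF` / `placeKitNF` over `V̲`,
# `baseKitNFOfBadPairs CG hS M hA hI B ΛBad` (genuine shape) and `baseKitNFStandIn CG hS M hA hI` (the `X̲→`-stand-in at bad places),
# with (α), (β) and Prop 6.6 (ii)(iii) / 6.8 (i) / Ex 6.3 (ii) re-derived ([IUTchI] Def 6.1; defs + laws — post-freeze additive D13, not a cone member)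

S. Mochizuki, *Inter-universal Teichmüller theory I*, kurims manuscript (May 2020), Def 6.1 (ii)–(vii) pp. 156–159, Def 4.1 (vi) p. 98, Ex 6.3
(i)(ii) p. 161, Prop 6.6 (ii)(iii) p. 165, Prop 6.8 (i) p. 167; pages = kurims preprint render ([IUTchI] Def 6.1 (ii) p.156) [claim: Mochizuki2012, status: disputed]
(D-0012 claim key, series status DISPUTED — constructions over abc-iut-L5-t2's REAL `InitialThetaData`, packaging `baseKitNFOfData` (J-NF-1,
PiAvatarBaseKitNF) exactly as `baseKit` (p445979) / `baseKitOfBadPairs`, `baseKitStandIn` (p448457) package `baseKitOfData`; abc-iut-L5-d5's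
theorems `localArrowLaw_L2_sign_local`, `localArrowLaw_local_of_torsionMonodromy` supply the local arrow laws; nothing of the series is
asserted, no side is taken on [IUTchIII] Cor. 3.12).

## What is built
* `baseKitNF B CG hS hsurj hA Λ` / `placeKitNF` (+ `_kit`), (α) `phiEllSync_baseKitNF`, (β) `negCompatModel_baseKitNF`;
* **`baseKitNFOfBadPairs CG hS M hA hI B ΛBad`** — binders `CG`, `hS`, `M : TorsionMonodromy` (NV #45), `hA`, `hI`, bad-place DATA `B` + laws
  `ΛBad` (the tempered `Π^tp_{X̳_v̲}` side, L3/[EtTh], after-merge); (α)(β) + the four §6 consumers;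
* **`baseKitNFStandIn CG hS M hA hI`** / `placeKitNFStandIn` «[`X̲→`-profinite stand-in at `v̲ ∈ V̲^bad`]: print's `𝒟_v̲` there is
  `ℬ^temp(X̳_v̲)⁰`, NOT this kit's `ℬ(Π_{X̲→_v̲})⁰`» — every kit binder discharged but the five standing ones; (α)(β) + the four §6 consumers;
  `baseKitNFStandIn_model_obj`. This is the kit over which abc-iut-L5-t3's `NFKit` assembly («nfKit-assembly») is to be typed.
No instance (the `Normal` instance comes from `M` by `haveI`), no notation; typed ≠ inhabited ≠ proved; binders ≠ facts.
-/

noncomputable section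

namespace Literature.IUT.HodgeTheaters

open CategoryTheory

universe u v w

section BaseKitNFInstances

variable {F : Type u} {K : Type v} {Fbar : Type w} [Field F] [NumberField F] [Field K] [NumberField K]
  [Algebra F K] [Field Fbar] [Algebra F Fbar] [Algebra K Fbar]
  {E : WeierstrassCurve F} [E.IsElliptic] {l : ℕ} {Pb : BadPlacePredicates K}
  (D : InitialThetaData F K Fbar E l Pb)

namespace InitialThetaData

/-! ### The NF kit over `V̲` -/

section OverPlaces

variable (B : ∀ v, v ∈ D.indexCopyBad → D.BadPairAt v) (CG : D.geom.pe.CuspGalois) (hS : D.CuspClassesNormaliserStable) [Fact l.Prime]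
  [(D.PiXund.subgroupOf D.PiXK).Normal] (hsurj : Function.Surjective D.toFlStarGlobal) (hA : D.geom.pe.ArrowCoveringClaims)
  (Λ : ∀ v, D.LocalArrowLaw CG hS (D.localGroupAt B v))

open Classical in
/-- **The NF-widened base kit of the initial Θ-data over `V̲`** (`baseKitNFOfData` at `localDatumAt`; cf. `baseKit`, p445979).
([IUTchI] Def 6.1 (ii)-(vii) pp.156-159) [claim: Mochizuki2012, status: disputed] -/
def baseKitNF : PMBaseKit.{w} l :=
  D.baseKitNFOfData CG hS hsurj D.indexCopyBad D.indexCopyArc (D.localDatumAt B CG hS hA Λ)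

open Classical in
/-- The NF-widened PLACE KIT over `V̲` (its kit is `baseKitNF`). ([IUTchI] Def 3.1 (e) p.62) [claim: Mochizuki2012, status: disputed] -/
def placeKitNF : PlaceKit.{w} D where
  kit := D.baseKitNF B CG hS hsurj hA Λ
  e := D.indexCopyEquiv
  mem_bad_iff := D.mem_indexCopyBad_iff
  mem_arc_iff := D.mem_indexCopyArc_iff

/-- Its kit is `baseKitNF`. ([IUTchI] Def 6.1 (ii) p.156) [claim: Mochizuki2012, status: disputed] -/
theorem placeKitNF_kit : (D.placeKitNF B CG hS hsurj hA Λ).kit = D.baseKitNF B CG hS hsurj hA Λ := rfl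

open Classical in
/-- **(α)** at `baseKitNF`. ([IUTchI] Ex 6.3 (i) p.161) [claim: Mochizuki2012, status: disputed] -/
theorem phiEllSync_baseKitNF : PMBaseKit.Ex63.PhiEllSync (D.baseKitNF B CG hS hsurj hA Λ) :=
  D.phiEllSync_baseKitNFOfData CG hS hsurj _ _ _

open Classical in
/-- **(β)** at `baseKitNF`. ([IUTchI] Ex 6.3 (ii) p.161) [claim: Mochizuki2012, status: disputed] -/
theorem negCompatModel_baseKitNF : PMBaseKit.Ex63.NegCompatModel (D.baseKitNF B CG hS hsurj hA Λ) :=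
  D.negCompatModel_baseKitNFOfData CG hS hsurj _ _ _

end OverPlaces

/-! ### The genuine-shape NF kit from a torsion monodromy -/

variable (CG : D.geom.pe.CuspGalois) (hS : D.CuspClassesNormaliserStable) [Fact l.Prime]
  (M : D.TorsionMonodromy) (hA : D.geom.pe.ArrowCoveringClaims)
  (hI : ∀ k ∈ D.geom.pe.inertia D.geom.pe.ε1, M.tau (D.geom.embK k) = 0)

section Genuine

variable (B : ∀ v, v ∈ D.indexCopyBad → D.BadPairAt v) (ΛBad : ∀ v (h : v ∈ D.indexCopyBad), D.LocalArrowLaw CG hS (B v h).H)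

/-- **THE GENUINE-SHAPE NF KIT**: `baseKitNF` with `[Normal]`/`hsurj` from `M`, the good-place laws d5's THEOREMS ((L1) from `M`, `hA`, `hI`;
(L2) from `hA`), the bad-place DATA `B` with its laws `ΛBad`. ([IUTchI] Def 6.1 (ii)-(vii) pp.156-159) [claim: Mochizuki2012, status: disputed] -/
def baseKitNFOfBadPairs : PMBaseKit.{w} l :=
  haveI := M.normal_PiXund_subgroupOf_PiXK
  D.baseKitNF B CG hS (D.toFlStarGlobal_surjective_of_torsionMonodromy M) hA
    (D.localArrowLawFamilyOfTorsionMonodromy CG hS M hA hI B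
      (fun v _ => D.localArrowLaw_L2_sign_local CG hS hA (D.decompAt v)) ΛBad)

/-- **(α)** at `baseKitNFOfBadPairs`. ([IUTchI] Ex 6.3 (i) p.161) [claim: Mochizuki2012, status: disputed] -/
theorem phiEllSync_baseKitNFOfBadPairs : PMBaseKit.Ex63.PhiEllSync (D.baseKitNFOfBadPairs CG hS M hA hI B ΛBad) := by
  haveI := M.normal_PiXund_subgroupOf_PiXK
  exact D.phiEllSync_baseKitNF B CG hS _ hA _

/-- **(β)** at `baseKitNFOfBadPairs`. ([IUTchI] Ex 6.3 (ii) p.161) [claim: Mochizuki2012, status: disputed] -/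
theorem negCompatModel_baseKitNFOfBadPairs : PMBaseKit.Ex63.NegCompatModel (D.baseKitNFOfBadPairs CG hS M hA hI B ΛBad) := by
  haveI := M.normal_PiXund_subgroupOf_PiXK
  exact D.negCompatModel_baseKitNF B CG hS _ hA _

/-- **[IUTchI] Prop 6.6 (ii)** at `baseKitNFOfBadPairs`. ([IUTchI] Prop 6.6 (ii) p.165) [claim: Mochizuki2012, status: disputed] -/
theorem isoTorsor_thetaEllBridge_baseKitNFOfBadPairs (B₁ B₂ : (D.baseKitNFOfBadPairs CG hS M hA hI B ΛBad).DThetaEllBridge) :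
    PMBaseKit.DThetaEllBridge.IsoTorsor B₁ B₂ :=
  PMBaseKit.DThetaEllBridge.isoTorsor_of_negCompatModel (D.negCompatModel_baseKitNFOfBadPairs CG hS M hA hI B ΛBad) B₁ B₂

/-- **[IUTchI] Prop 6.6 (iii)** at `baseKitNFOfBadPairs`. ([IUTchI] Prop 6.6 (iii) p.165) [claim: Mochizuki2012, status: disputed] -/
theorem isoTorsor_thetaPMEllHT_baseKitNFOfBadPairs (H₁ H₂ : (D.baseKitNFOfBadPairs CG hS M hA hI B ΛBad).DThetaPMEllHT) :
    PMBaseKit.DThetaPMEllHT.IsoTorsor H₁ H₂ :=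
  PMBaseKit.DThetaPMEllHT.isoTorsor_of_negCompatModel (D.negCompatModel_baseKitNFOfBadPairs CG hS M hA hI B ΛBad) H₁ H₂

/-- **[IUTchI] Prop 6.8 (i)** at `baseKitNFOfBadPairs`. ([IUTchI] Prop 6.8 (i) p.167) [claim: Mochizuki2012, status: disputed] -/
theorem ellBridgeSymmetry_baseKitNFOfBadPairs (H : (D.baseKitNFOfBadPairs CG hS M hA hI B ΛBad).DThetaPMEllHT) :
    PMBaseKit.DThetaPMEllHT.EllBridgeSymmetry H :=
  PMBaseKit.DThetaPMEllHT.ellBridgeSymmetry_of_negCompatModel (D.negCompatModel_baseKitNFOfBadPairs CG hS M hA hI B ΛBad) H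

/-- **[IUTchI] Ex 6.3 (ii)** (negative `γ`) at `baseKitNFOfBadPairs`. ([IUTchI] Ex 6.3 (ii) p.161) [claim: Mochizuki2012, status: disputed] -/
theorem equivariant_baseKitNFOfBadPairs {γ : FlPM l} (hγ : γ.IsNegative) :
    PMBaseKit.Ex63.Equivariant (D.baseKitNFOfBadPairs CG hS M hA hI B ΛBad) γ :=
  (D.negCompatModel_baseKitNFOfBadPairs CG hS M hA hI B ΛBad).equivariant hγ

end Genuine

/-! ### The NF kit at the `X̲→`-stand-in: binders {`CG`, `hS`, `M`, `hA`, `hI`} -/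

/-- **THE NF STAND-IN KIT** — `baseKitNFOfBadPairs` at `B := badPairAtArrow hA` with the bad-index laws d5's `localArrowLaw_local_of_torsionMonodromy`
(the `X̲→`-recipe law). «[`X̲→`-profinite stand-in at `v̲ ∈ V̲^bad`]»: NOT print's tempered `ℬ^temp(X̳_v̲)⁰`.
([IUTchI] Def 6.1 (ii)-(vii) pp.156-159) [claim: Mochizuki2012, status: disputed] -/
def baseKitNFStandIn : PMBaseKit.{w} l :=
  D.baseKitNFOfBadPairs CG hS M hA hI (fun v _ => D.badPairAtArrow hA v)
    (fun v _ => D.localArrowLaw_local_of_torsionMonodromy CG hS M hA hI (D.decompAt v))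

open Classical in
/-- The NF stand-in PLACE KIT over `V̲`. ([IUTchI] Def 3.1 (e) p.62) [claim: Mochizuki2012, status: disputed] -/
def placeKitNFStandIn : PlaceKit.{w} D where
  kit := D.baseKitNFStandIn CG hS M hA hI
  e := D.indexCopyEquiv
  mem_bad_iff := D.mem_indexCopyBad_iff
  mem_arc_iff := D.mem_indexCopyArc_iff

/-- Its kit is `baseKitNFStandIn`. ([IUTchI] Def 6.1 (ii) p.156) [claim: Mochizuki2012, status: disputed] -/
theorem placeKitNFStandIn_kit : (D.placeKitNFStandIn CG hS M hA hI).kit = D.baseKitNFStandIn CG hS M hA hI := rfl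

/-- The ambient of the NF stand-in kit at an index is the NF-widened `AmbNF` of its local datum (J-NF-1).
([IUTchI] Def 6.1 (vii) p.159) [claim: Mochizuki2012, status: disputed] -/
theorem baseKitNFStandIn_Amb (v : D.IndexCopy) :
    (D.baseKitNFStandIn CG hS M hA hI).Amb v =
      (D.localDatumAt (fun v _ => D.badPairAtArrow hA v) CG hS hA
        (D.localArrowLawFamilyOfTorsionMonodromy CG hS M hA hI (fun v _ => D.badPairAtArrow hA v)
          (fun v _ => D.localArrowLaw_L2_sign_local CG hS hA (D.decompAt v))
          (fun v _ => D.localArrowLaw_local_of_torsionMonodromy CG hS M hA hI (D.decompAt v))) v).AmbNF := rfl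

/-- The local group of the NF stand-in kit at EVERY index is `Π_{X̲→_K} ∩ augGF⁻¹ G_v̲`. ([IUTchI] Def 3.1 (f) p.63) [claim: Mochizuki2012, status: disputed] -/
theorem baseKitNFStandIn_model_obj (v : D.IndexCopy) :
    ((D.baseKitNFStandIn CG hS M hA hI).model v).obj = OrbitCat.of (D.PiXarrow ⊓ (D.decompAt v).comap D.augGF) := by
  change (D.localDatumAt (fun v _ => D.badPairAtArrow hA v) CG hS hA _ v).locObj = _
  rw [LocalDatum.locObj, D.localDatumAt_H, D.localGroupAt_badPairAtArrow]

/-- **(α)** at `baseKitNFStandIn`. ([IUTchI] Ex 6.3 (i) p.161) [claim: Mochizuki2012, status: disputed] -/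
theorem phiEllSync_baseKitNFStandIn : PMBaseKit.Ex63.PhiEllSync (D.baseKitNFStandIn CG hS M hA hI) :=
  D.phiEllSync_baseKitNFOfBadPairs CG hS M hA hI _ _

/-- **(β)** at `baseKitNFStandIn`. ([IUTchI] Ex 6.3 (ii) p.161) [claim: Mochizuki2012, status: disputed] -/
theorem negCompatModel_baseKitNFStandIn : PMBaseKit.Ex63.NegCompatModel (D.baseKitNFStandIn CG hS M hA hI) :=
  D.negCompatModel_baseKitNFOfBadPairs CG hS M hA hI _ _

/-- **[IUTchI] Prop 6.6 (ii)** at `baseKitNFStandIn`. ([IUTchI] Prop 6.6 (ii) p.165) [claim: Mochizuki2012, status: disputed] -/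
theorem isoTorsor_thetaEllBridge_baseKitNFStandIn (B₁ B₂ : (D.baseKitNFStandIn CG hS M hA hI).DThetaEllBridge) :
    PMBaseKit.DThetaEllBridge.IsoTorsor B₁ B₂ :=
  PMBaseKit.DThetaEllBridge.isoTorsor_of_negCompatModel (D.negCompatModel_baseKitNFStandIn CG hS M hA hI) B₁ B₂

/-- **[IUTchI] Prop 6.6 (iii)** at `baseKitNFStandIn`. ([IUTchI] Prop 6.6 (iii) p.165) [claim: Mochizuki2012, status: disputed] -/
theorem isoTorsor_thetaPMEllHT_baseKitNFStandIn (H₁ H₂ : (D.baseKitNFStandIn CG hS M hA hI).DThetaPMEllHT) :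
    PMBaseKit.DThetaPMEllHT.IsoTorsor H₁ H₂ :=
  PMBaseKit.DThetaPMEllHT.isoTorsor_of_negCompatModel (D.negCompatModel_baseKitNFStandIn CG hS M hA hI) H₁ H₂

/-- **[IUTchI] Prop 6.8 (i)** at `baseKitNFStandIn`. ([IUTchI] Prop 6.8 (i) p.167) [claim: Mochizuki2012, status: disputed] -/
theorem ellBridgeSymmetry_baseKitNFStandIn (H : (D.baseKitNFStandIn CG hS M hA hI).DThetaPMEllHT) :
    PMBaseKit.DThetaPMEllHT.EllBridgeSymmetry H :=
  PMBaseKit.DThetaPMEllHT.ellBridgeSymmetry_of_negCompatModel (D.negCompatModel_baseKitNFStandIn CG hS M hA hI) H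

/-- **[IUTchI] Ex 6.3 (ii)** (negative `γ`) at `baseKitNFStandIn`. ([IUTchI] Ex 6.3 (ii) p.161) [claim: Mochizuki2012, status: disputed] -/
theorem equivariant_baseKitNFStandIn {γ : FlPM l} (hγ : γ.IsNegative) :
    PMBaseKit.Ex63.Equivariant (D.baseKitNFStandIn CG hS M hA hI) γ :=
  (D.negCompatModel_baseKitNFStandIn CG hS M hA hI).equivariant hγ

end InitialThetaData

end BaseKitNFInstances

end Literature.IUT.HodgeTheaters
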